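import Literature.Barriers.QuantumAdvantage.AaronsonChenAdvicePSPACE
import Literature.Barriers.QuantumAdvantage.AaronsonChenPhysicsPSPACE
import Literature.Barriers.QuantumAdvantage.TQBFFlatStepCode
import HarnessLib

/-!
# Aaronson–Chen 2017, Lemma 5.3 holds (discharge of `aaronsonChen2017_lem53` and `aaronsonChen2017_lem53_machine`)

Sibling proof file of `AaronsonChenOracle.lean` (D-0014). The named fact
`Literature.Barriers.QuantumAdvantage.aaronsonChen2017_lem53` — Aaronson–Chen, *Complexity-theoretic
foundations of quantum supremacy experiments*, CCC 2017, **Lemma 5.3** (p. 21; proof pp. 21–23): for a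
`SampBQP^{TQBF,O}` algorithm `M` there is a PPT classical oracle algorithm `A` such that, with
probability at least `1 − exp(−(2|x| + 1/ε))` over `O ∼ D_O`, the output law of `A^{TQBF,O}` on
`⟨x, 0^{1/ε}⟩` is `ε`-close to that of `M^{TQBF,O}` — is DISCHARGED here by assembling the tree's
formalization of the printed proof:

* the probabilistic half (replacement process, hybrid bound eq. (10), posterior/Chernoff analysis
  eqs. (7)–(9), Cor. 2.7): `AaronsonChenSimulation.lean`, `AaronsonChenPosterior.lean`,
  `AaronsonChenSimulationProofs.lean` (`aaronsonChen2017_lem53_losses_holds`,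
  `aaronsonChen2017_lem53_of_machine`);
* the machine half ("So `A` is a `SampBPP` algorithm", p. 23): the protocol and the PPT oracle
  adversary (`AaronsonChenTables/Protocol/ProtocolProofs/Machine.lean`), its advice language reduced
  to two physical predicates (`AaronsonChenAdvice/AdviceMaps/AdvicePSPACE.lean`:
  `aaronsonChen2017_lem53_of_physics`), and those predicates in `PSPACE` ("all the computations can be
  done in `PSPACE`": `AaronsonChenAdviceWeights.lean`, `AaronsonChenPhysicsPSPACE.lean`:
  `AcProto.physics_mem_PSPACE`, through `GuessedAnnRuns.lean`, `GapNatPSpace.lean` and the tree's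
  `TQBF_mem_PSPACE`);
* the `PSPACE`-hardness of `TQBF` (Stockmeyer–Meyer; Arora–Barak Thm. 4.13), the tree's
  `TQBFRed.isHard_PSPACE_TQBF` (`TQBFFlatStepCode.lean`).

Also discharged: the machine fact `aaronsonChen2017_lem53_machine` (`AaronsonChenSimulation.lean`),
consumed by `AaronsonChenThm51OfMachine.lean` (Theorem 5.1 from Lemma 5.3).

## References

* [AaronsonChen2017] S. Aaronson, L. Chen, CCC 2017 (doi:10.4230/LIPIcs.CCC.2017.22;
  arXiv:1612.05903), Lemma 5.3 (p. 21; proof §5.3, pp. 21–23), read via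
  `lit read arxiv:1612.05903 --pages 19-25`.
* [AroraBarakCC2009] Thm. 4.13 (`TQBF` is `PSPACE`-complete).
-/

namespace Literature.Barriers.QuantumAdvantage

open _root_.Computability Literature.Computability.Complexity Literature.Computability.Cryptography
  Literature.Computability.QuantumComplexity

/-- **Aaronson–Chen 2017, Lemma 5.3, machine half** — discharge of the named fact
`aaronsonChen2017_lem53_machine`: the PPT oracle adversary simulating the replaced run within total
variation `1/2k` for every `O`, from the `PSPACE`-hardness of `TQBF` and the `PSPACE`-membership of the
advice language (`advLang_mem_PSPACE` with the two physical predicates discharged by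
`AcProto.physics_mem_PSPACE`). [cite: AaronsonChen2017, Lemma 5.3 (§5.3 p. 23, "So A is a SampBPP algorithm")] [cite: AroraBarakCC2009, Thm. 4.13] -/
theorem aaronsonChen2017_lem53_machine_holds : aaronsonChen2017_lem53_machine :=
  aaronsonChen2017_lem53_machine_of_advice TQBFRed.isHard_PSPACE_TQBF fun P hU hpost hP =>
    P.advLang_mem_PSPACE hP hpost (P.physics_mem_PSPACE hU hpost hP).1 (P.physics_mem_PSPACE hU hpost hP).2

/-- **Aaronson–Chen 2017, Lemma 5.3** — discharge of the named fact `aaronsonChen2017_lem53`: for every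
`SampBQP^{TQBF,O}` algorithm (uniform Clifford+T query-circuit family with polynomial-time
post-processing) there is a PPT classical `TQBF ⊕ O`-oracle algorithm whose output law on
`⟨x, 1^k⟩` is `1/k`-close to the quantum one with probability `≥ 1 − exp(−(2|x| + k))` over the
Aaronson–Chen oracle distribution. [cite: AaronsonChen2017, Lemma 5.3 (p. 21; proof pp. 21–23)] [cite: AroraBarakCC2009, Thm. 4.13] -/
theorem aaronsonChen2017_lem53_holds : aaronsonChen2017_lem53 :=
  aaronsonChen2017_lem53_of_physics TQBFRed.isHard_PSPACE_TQBF AcProto.physics_mem_PSPACE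

end Literature.Barriers.QuantumAdvantage
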